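import Summits.BirchSwinnertonDyer.Rank1Residual.Partition.Rows
import Literature.NumberTheory.EllipticCurves.Rank1Residual.Typed.PAdicCertificateMultiplicativeExists
import Literature.NumberTheory.EllipticCurves.Rank1Residual.X9NoEntry
import Literature.NumberTheory.EllipticCurves.PAdicLFunctionNonsplitMultiplicativeExistenceProofs
import Literature.NumberTheory.EllipticCurves.PAdicHeightsLInvariantHoldsProofs
import Literature.NumberTheory.EllipticCurves.PAdicBSDSplitMultiplicativeProofs
import HarnessLib

/-!
# Class X11b (lane CLASS-CLOSURE, class N8/O2): the `p`-adic LEVER on the (ram) atom — main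
# conjecture EQUALITY (Skinner 2016 Thm. A) + Jones's algebraic leading term (Stein–Wuthrich 2013
# Thm. 6.1) + Disegni's RELATIVE analytic leading term (Kyoto J. Math. 2020 Thm. 1) ⇒ `BSD(E,p)`
# modulo ONE per-pair input: non-degeneracy of THE canonical `p`-adic height (cell `b2b-bsdres`,
# seat `cc-typer-3`)

HONEST FRAMING (verbatim, cell `b2b-bsdres`, run/shared/lean/b2b/bsd-rank1-residual/): the goal of
the cell is to DELETE the COMBINATION-SHAPED residual classes for ALL analytic-rank `≤ 1` curves
over `ℚ` — "full BSD formula for every rank `≤ 1` curve in class `C`" assembled STRICTLY from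
published theorems — so that the rank-`≤ 1` remainder becomes exactly the CONSTRUCTION-SHAPED
classes, which are TYPED (missing-input Props), NOT attempted; this is not "finishing BSD".
Lane CLASS-CLOSURE (coordinator ruling 2026-08-21T04:07Z), experiment type (2) OBSTRUCTION ANATOMY
→ SUB-PARTITION for the open class N8/O2 = X11b (`p ‖ N`, `r = 1`, `E[p]` irreducible): "take the
neighbouring published proof and census exactly which hypothesis fails on which pairs … sub-classes
where the existing argument extends near-verbatim (→ provers) vs the irreducible new sub-case".
THEOREMS ONLY (no definition, no named fact, no `sorry`); nothing booked; X11b stays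
CONSTRUCTION-SHAPED; every theorem is CONDITIONAL on the named published facts it lists AND on the
per-pair input `SchneiderConjecture Dh` (`Reg_p(E, Dh) ≠ 0` for THE canonical datum).

## The neighbouring published argument and what it needs, atom by atom

The cell's `p`-adic certificate engine (`Typed/PAdicCertificateEngine.lean`, Miller 2011 Prop. 7.6)
closes a pair from a one-sided divisibility + a COMPUTED valuation of the analytic leading term +
`p ∤ #Ш_an`. On the (ram) atom of X11b (`Ram W p`: a second multiplicative prime at which `E[p]`
ramifies — ALL 1 684 true-open X11b classes at `p = 3` and 3 723 of the 3 861 cells at `p ≥ 5` of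
the R196 ledger are (ram), `b2b-bsdres-rmap-3/g5/x11b3left/`, `…/x11b5left/`) three PUBLISHED
theorems replace every computed / unit hypothesis of that engine:
* (MC=) Skinner, Pacific J. Math. 283 (2016) Thm. A at `p ‖ N`, `p ≥ 3`, (irr) + (ram): the
  cyclotomic main conjecture as an EQUALITY of ideals of `Λ`, `ι(T^{e}·g·w) = ϖ·L` with `w ∈ Λˣ`
  (tree fact `Skinner2016.thmA_charIdeal_multiplicative`; `e = 1` split, `0` non-split);
* (J) Stein–Wuthrich, Math. Comp. 82 (2013) Thm. 6.1 (Schneider, Perrin-Riou, Jones 1989) at a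
  multiplicative `p ≠ 2`: `ord_T g ≥ r`, `= r` iff `Reg_p ≠ 0 ∧ Ш[p^∞]` finite, and then
  `[T^r]g · log_p(γ)^{r+e} · #E(ℚ)_tors² = u · ε · #Ш[p^∞] · Reg_p(Dh) · ∏ c_v`, `ε = 2` (non-split)
  / `𝓛_p` (split) (tree facts `SteinWuthrich2013.thm61_{nonsplit,split}Multiplicative`);
* (D) Disegni, Kyoto J. Math. 60 (2020) Thm. 1 in analytic rank one at a multiplicative prime: the
  SAME display with `g` replaced by the MTT function `ϖ·L` and `#Ш[p^∞]` by `#Ш_an`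
  (named fact `Disegni2020.thm1_padicBSD_rankOne_multiplicative`, proposed alongside this file; HERE its
  conclusion AT THE PAIR is an explicit hypothesis `hD`, so this file depends on no new fact: non-split
  ANY odd `p`; split `p ≥ 5` with a second multiplicative prime — which (ram) supplies).
Chain (`padicValRat_eq_padicValNat_of_leadingTerms`, pure algebra): `[T^{r+e}](ϖL) = [T^r]g · w(0)`
(`ord_T g ≥ r`, `w` a unit) and the two displays give `u·w(0)·#Ш[p^∞] = u'·#Ш_an` after cancelling
`ε·Reg_p·∏ c_v ≠ 0` — i.e. `ord_p #Ш_an = ord_p #Ш[p^∞]` = Miller's `BSD(E,p)` for ANY `#Ш_an`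
(no `p ∤ #Ш_an`, no computed valuation, no Tamagawa / Heegner-index / anticyclotomic input), granted
`Reg_p(Dh) ≠ 0` to put `g` in the equality case of (J).

## Sub-partition of N8/O2 obtained (typed by name in `X11b/ClassClosureTyped.lean`)

* (ram) ∧ NON-SPLIT at `p`, ANY odd `p` (so `p = 3` INCLUDED): `BSD(E,p)` ⇐ (MC=) + (J) + (D) +
  SW §4.2 height existence + GZK + modularity + `SchneiderConjecture Dh` per pair
  (`bsdp_of_ram_nonsplit_of_schneider`). VERBATIM-EXTENSION PART → provers / instruments: the only
  per-pair input is a `p`-adic regulator non-vanishing certificate (one canonical height of the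
  Mordell–Weil generator; cost independent of the conductor), or class-wide Schneider's conjecture
  (barrier `Literature/Barriers/BirchSwinnertonDyer/PAdicHeightNondegeneracyProofs.lean`).
* (ram) ∧ SPLIT at `p ≥ 5`: the same with `𝓛_p ≠ 0` (BDGP, tree theorem `LInvariant_ne_zero_holds`)
  (`bsdp_of_ram_split_of_five_le_of_schneider`).
* (ram) ∧ SPLIT at `p = 3`: the IRREDUCIBLE RESIDUE of this lever — Disegni's Thm. 1 has "`p ≥ 5`"
  in hypothesis (∗) (Venerucci's exceptional-zero formula); the `p = 3` statement is typed as an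
  EVIDENCE-labelled conjecture in `X11b/ClassClosureTyped.lean` (census X11-REPORT v3: 150/150 split
  rank-one pairs at `p = 3`), and `bsdp_of_split_of_relativeLeadingTerm_of_schneider` below is its
  consumer (datum level, the relative display as a hypothesis).
* `¬(ram)`: Skinner's Thm. A needs (ram); not reached here (0 of the open X11b classes at `p = 3`).
The one-statement form on the whole (ram) atom minus "split at `3`", with the NAMED fact, is in
`X11b/ClassClosureTyped.lean`.

References: [Skinner2016PacificMC] Thm. A, §3.2–3.3; [SteinWuthrich2013] Thm. 6.1, §4.2;
[Disegni2020] Thm. 1 (§1.2) = Thm. 4 (§3.2); [Miller2011LMS] Def. 1.1, Prop. 7.6;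
[MazurTateTeitelbaum1986Invent] §I.14, §II.10; [GreenbergLNM1716] §4.
-/

set_option autoImplicit false

noncomputable section

open scoped Classical MatrixGroups ModularForm

open CongruenceSubgroup WeierstrassCurve Literature.NumberTheory.EllipticCurves
  Literature.NumberTheory.EllipticCurves.ModularForms
  Literature.NumberTheory.EllipticCurves.Rank1Residual
  Literature.NumberTheory.EllipticCurves.Rank1Residual.Typed
  Literature.NumberTheory.EllipticCurves.Skinner2016
  Literature.NumberTheory.EllipticCurves.SteinWuthrich2013
  Literature.NumberTheory.EllipticCurves.Wuthrich2014

namespace Summit.BirchSwinnertonDyer.Rank1Residual.X11b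

/-! ### The algebraic core: two leading-term displays and a unit cofactor -/

/-- **Core of the lever (pure algebra).** In `ℚ_p`: if `cL = gₙ · w₀` with `w₀ ∈ ℤ_p` a unit (the
order-`n` coefficient of `ι(g·w) = c·L` when `ord_T g ≥ n`), `gₙ · B = u · (M · #S)` (the algebraic
leading term, `#S = #Ш[p^∞]`) and `cL · B = u' · (M · s)` (the analytic leading term against
`s = #Ш_an`) with `M ≠ 0` and units `u, u'`, then `ord_p s = ord_p #S`. [folklore] -/
theorem padicValRat_eq_padicValNat_of_leadingTerms {p : ℕ} [Fact p.Prime] {gn w0 : ℤ_[p]}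
    (hw0 : IsUnit w0) {cL B M : ℚ_[p]} (hM : M ≠ 0) {s : ℚ} {S : ℕ} (hS : S ≠ 0) (u u' : ℤ_[p]ˣ)
    (hι : cL = ((gn * w0 : ℤ_[p]) : ℚ_[p]))
    (hJ : ((gn : ℤ_[p]) : ℚ_[p]) * B = ((u : ℤ_[p]) : ℚ_[p]) * (M * (S : ℚ_[p])))
    (hA : cL * B = ((u' : ℤ_[p]) : ℚ_[p]) * (M * (s : ℚ_[p]))) :
    padicValRat p s = padicValNat p S := by
  set w0u : ℤ_[p]ˣ := hw0.unit with hw0u_def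
  have hw0c : ((w0u : ℤ_[p]) : ℚ_[p]) = ((w0 : ℤ_[p]) : ℚ_[p]) := by rw [hw0u_def, IsUnit.unit_spec]
  -- `u' · M · s = u · w₀ · M · S`
  have key : ((u' : ℤ_[p]) : ℚ_[p]) * (M * (s : ℚ_[p])) =
      ((u : ℤ_[p]) : ℚ_[p]) * ((w0u : ℤ_[p]) : ℚ_[p]) * (M * (S : ℚ_[p])) := by
    rw [← hA, hι, hw0c]
    push_cast
    linear_combination ((w0 : ℤ_[p]) : ℚ_[p]) * hJ
  -- cancel `M`
  have key' : ((u' : ℤ_[p]) : ℚ_[p]) * (s : ℚ_[p]) =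
      ((u : ℤ_[p]) : ℚ_[p]) * ((w0u : ℤ_[p]) : ℚ_[p]) * (S : ℚ_[p]) := by
    apply mul_left_cancel₀ hM
    linear_combination key
  have hS0 : (S : ℚ_[p]) ≠ 0 := by exact_mod_cast hS
  have hs0 : (s : ℚ_[p]) ≠ 0 := by
    intro h0
    rw [h0, mul_zero] at key'
    exact (mul_ne_zero (mul_ne_zero (coe_units_ne_zero p u) (coe_units_ne_zero p w0u)) hS0) key'.symm
  have hval := congrArg Padic.valuation key'
  rw [Padic.valuation_mul (coe_units_ne_zero p u') hs0,
    Padic.valuation_mul (mul_ne_zero (coe_units_ne_zero p u) (coe_units_ne_zero p w0u)) hS0,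
    Padic.valuation_mul (coe_units_ne_zero p u) (coe_units_ne_zero p w0u),
    valuation_coe_units_eq_zero, valuation_coe_units_eq_zero, valuation_coe_units_eq_zero,
    Padic.valuation_ratCast, Padic.valuation_natCast] at hval
  simpa using hval

/-- The order-`(n+e)` coefficient of `ι(T^e · g · w) = c · L` is `gₙ · w(0)` when `ord_T g ≥ n`
(all lower coefficients of `g` vanish). [folklore] -/
theorem coeff_eq_mul_constantCoeff_of_le_order {p : ℕ} [Fact p.Prime] {g : IwasawaAlgebra p}
    (w : IwasawaAlgebra p) {n : ℕ} (hn : (n : ℕ∞) ≤ g.order) (e : ℕ) {c : ℚ_[p]}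
    {L : PowerSeries ℚ_[p]}
    (hw : iwasawaToPowerSeries p ((PowerSeries.X : IwasawaAlgebra p) ^ e * g * w) =
      PowerSeries.C c * L) :
    c * PowerSeries.coeff (n + e) L =
      ((PowerSeries.coeff n g * PowerSeries.constantCoeff w : ℤ_[p]) : ℚ_[p]) := by
  have h1 : PowerSeries.coeff (n + e) (PowerSeries.C c * L) = c * PowerSeries.coeff (n + e) L :=
    PowerSeries.coeff_C_mul _ _ _
  have h2 : PowerSeries.coeff (n + e)
      (iwasawaToPowerSeries p ((PowerSeries.X : IwasawaAlgebra p) ^ e * g * w)) =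
      ((PowerSeries.coeff n (g * w) : ℤ_[p]) : ℚ_[p]) := by
    rw [coeff_iwasawaToPowerSeries, mul_assoc, PowerSeries.coeff_X_pow_mul', if_pos (Nat.le_add_left e n),
      Nat.add_sub_cancel]
  -- `[T^n](g·w) = gₙ · w₀` since `g_i = 0` for `i < n`
  have h3 : (PowerSeries.coeff n (g * w) : ℤ_[p]) =
      PowerSeries.coeff n g * PowerSeries.constantCoeff w := by
    rw [PowerSeries.coeff_mul, Finset.Nat.sum_antidiagonal_eq_sum_range_succ
      (fun i j => PowerSeries.coeff i g * PowerSeries.coeff j w), Finset.sum_range_succ,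
      Nat.sub_self, PowerSeries.coeff_zero_eq_constantCoeff]
    rw [Finset.sum_eq_zero, zero_add]
    intro i hi
    have hi' : i < n := Finset.mem_range.mp hi
    rw [PowerSeries.coeff_of_lt_order i (lt_of_lt_of_le (by exact_mod_cast hi') hn), zero_mul]
  rw [← h1, ← hw, h2, h3]

/-! ### Datum level: the lever at ONE pair, every datum explicit -/

section Datum

variable (W : WeierstrassCurve ℚ) [W.IsElliptic] [W.IsGloballyMinimal] (p : ℕ) [Fact p.Prime]
  {κ : ZpExtension ℚ p} {γ : Field.absoluteGaloisGroup ℚ}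

/-- **The lever at one pair, NON-SPLIT multiplicative `p ≠ 2`, analytic rank `1`.** Data: the Tate
parameter `q`, cyclotomic `(κ, γ)`, a dual datum `D` of `Sel_{p^∞}(E/ℚ_∞)`, a generator `g` of
`char_Λ X`, a unit `w ∈ Λˣ` and `c ∈ ℚ_pˣ` with `ι(g·w) = c·L` (the main-conjecture EQUALITY for
THIS data — Skinner 2016 Thm. A on (ram), `c = ϖ`), THE §4.2 height `Dh`. Inputs: Jones's clause
(`hJ`), the relative analytic display AT THE PAIR (`hDis`: `c·[T¹]L·log_p γ·#T² = u'·2·#Ш_an·Reg_p·∏c`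
with `#Ш_an = s ∈ ℚ` — Disegni's Thm. 1 non-split, or any source), GZK (`hGZK`), and the per-pair
input `SchneiderConjecture Dh`. Output: `BSD(E,p)`, any `#Ш_an`. CONDITIONAL; nothing booked.
[cite: SteinWuthrich2013, Thm. 6.1 (p. 20) and §4.2] [cite: Disegni2020, Thm. 1 (§1.2)]
[cite: Miller2011LMS, Def. 1.1] -/
theorem bsdp_of_nonsplit_of_relativeLeadingTerm_of_schneider (hJ : thm61_nonsplitMultiplicative)
    (hGZK : rank_eq_analyticRank_of_analyticRank_le_one) (hp : p ≠ 2) (hr : W.analyticRank = 1)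
    (hmult : W.HasMultiplicativeReductionAtPrime p) (hns : ¬ W.HasSplitMultiplicativeReductionAtPrime p)
    {q : ℚ_[p]} (hq0 : q ≠ 0) (hq1 : ‖q‖ < 1) (hqj : tateJ q = (W.j : ℚ_[p]))
    (hκ : κ.IsCyclotomic) (hγ : κ.IsTopGenerator γ) (hγ' : IsCyclotomicVariable p γ)
    (D : W.SelmerDualData κ γ) (hX : D.IsTorsion) {g : IwasawaAlgebra p}
    (hchar : D.charIdeal = Ideal.span {g}) (w : (IwasawaAlgebra p)ˣ) {c : ℚ_[p]}
    {L : PowerSeries ℚ_[p]}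
    (hw : iwasawaToPowerSeries p (g * (w : IwasawaAlgebra p)) = PowerSeries.C c * L)
    (Dh : PAdicHeightData W p) (hDh : IsMultCanonical Dh q)
    {s : ℚ} (hs : shaAn W = (s : ℂ)) (u' : ℤ_[p]ˣ)
    (hDis : c * PowerSeries.coeff 1 L * padicLog p (cyclotomicGenerator p) *
        (W.torsionOrder : ℚ_[p]) ^ 2 =
      ((u' : ℤ_[p]) : ℚ_[p]) * (2 * ((s : ℚ_[p]) * padicRegulator Dh * W.tamagawaProduct)))
    (hSch : SchneiderConjecture Dh) : BSDp W p := by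
  haveI : Module.Finite (IwasawaAlgebra p) D.X := D.module_finite_holds hγ
  obtain ⟨hrank, hfin⟩ := hGZK W (by omega)
  have hr1 : W.mordellWeilRank = 1 := by rw [hrank, hr]
  haveI : Finite W.sha := hfin
  haveI hfinp : Finite (AddCommGroup.primaryComponent W.sha p) := inferInstance
  -- Jones: `ord_T g ≥ 1` and the leading term at order `1`
  obtain ⟨hle, -, h3⟩ := hJ W p hp hmult hns q hq0 hq1 hqj κ γ hκ hγ hγ' D hX g hchar Dh hDh
  obtain ⟨u, hu⟩ := h3 hSch hfinp
  rw [hr1] at hle hu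
  simp only [pow_one] at hu
  -- `c · [T¹]L = g₁ · w(0)`
  have hι : c * PowerSeries.coeff 1 L =
      ((PowerSeries.coeff 1 g * PowerSeries.constantCoeff (w : IwasawaAlgebra p) : ℤ_[p]) : ℚ_[p]) := by
    have := coeff_eq_mul_constantCoeff_of_le_order (w : IwasawaAlgebra p) hle 0 (c := c) (L := L)
      (by simpa using hw)
    simpa using this
  have hwu : IsUnit (PowerSeries.constantCoeff (w : IwasawaAlgebra p)) :=
    PowerSeries.isUnit_constantCoeff _ w.isUnit
  -- the core, with `B = log_p γ · #T²`, `M = 2 · Reg_p · ∏ c_v`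
  have hReg : padicRegulator Dh ≠ 0 := hSch
  have hc0 : (W.tamagawaProduct : ℚ_[p]) ≠ 0 := by
    exact_mod_cast (W.tamagawaProduct_pos_holds : 0 < W.tamagawaProduct).ne'
  have hM : (2 : ℚ_[p]) * padicRegulator Dh * (W.tamagawaProduct : ℚ_[p]) ≠ 0 :=
    mul_ne_zero (mul_ne_zero two_ne_zero hReg) hc0
  have hS : Nat.card (AddCommGroup.primaryComponent W.sha p) ≠ 0 := Nat.card_pos.ne'
  have hval : padicValRat p s = padicValNat p (Nat.card (AddCommGroup.primaryComponent W.sha p)) :=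
    padicValRat_eq_padicValNat_of_leadingTerms (p := p) hwu hM hS u u'
      (cL := c * PowerSeries.coeff 1 L)
      (B := padicLog p (cyclotomicGenerator p) * (W.torsionOrder : ℚ_[p]) ^ 2) hι
      (by linear_combination hu) (by linear_combination hDis)
  exact ⟨hrank, hfinp, s, hs, hval⟩

/-- **The lever at one pair, SPLIT multiplicative `p ≠ 2`, analytic rank `1`.** As
`bsdp_of_nonsplit_of_relativeLeadingTerm_of_schneider` with the exceptional-zero shapes: the
main-conjecture equality reads `ι(T·g·w) = c·L`, Jones's clause carries `𝓛_p = LInvariant Dq` and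
`log_p(γ)²`, and the relative display AT THE PAIR is
`c·[T²]L·log_p(γ)²·#T² = u'·𝓛_p·#Ш_an·Reg_p·∏c` (Disegni Thm. 1 split for `p ≥ 5` + a second
multiplicative prime; at `p = 3` NO source — the typed conjecture of `ClassClosureTyped.lean`).
`𝓛_p ≠ 0` is the tree theorem `LInvariant_ne_zero_holds` (Barré-Sirieix–Diaz–Gramain–Philibert).
CONDITIONAL; nothing booked. [cite: SteinWuthrich2013, Thm. 6.1 (p. 20) and §4.2]
[cite: Disegni2020, Thm. 4 second bullet (§3.2)] [cite: Miller2011LMS, Def. 1.1] -/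
theorem bsdp_of_split_of_relativeLeadingTerm_of_schneider (hJ : thm61_splitMultiplicative)
    (hGZK : rank_eq_analyticRank_of_analyticRank_le_one) (hp : p ≠ 2) (hr : W.analyticRank = 1)
    (Dq : TateParameterData W p)
    (hκ : κ.IsCyclotomic) (hγ : κ.IsTopGenerator γ) (hγ' : IsCyclotomicVariable p γ)
    (D : W.SelmerDualData κ γ) (hX : D.IsTorsion) {g : IwasawaAlgebra p}
    (hchar : D.charIdeal = Ideal.span {g}) (w : (IwasawaAlgebra p)ˣ) {c : ℚ_[p]}
    {L : PowerSeries ℚ_[p]}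
    (hw : iwasawaToPowerSeries p ((PowerSeries.X : IwasawaAlgebra p) * g * (w : IwasawaAlgebra p)) =
      PowerSeries.C c * L)
    (Dh : PAdicHeightData W p) (hDh : IsSplitMultCanonical Dh Dq)
    {s : ℚ} (hs : shaAn W = (s : ℂ)) (u' : ℤ_[p]ˣ)
    (hDis : c * PowerSeries.coeff 2 L * padicLog p (cyclotomicGenerator p) ^ 2 *
        (W.torsionOrder : ℚ_[p]) ^ 2 =
      ((u' : ℤ_[p]) : ℚ_[p]) * (LInvariant Dq * ((s : ℚ_[p]) * padicRegulator Dh * W.tamagawaProduct)))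
    (hSch : SchneiderConjecture Dh) : BSDp W p := by
  haveI : Module.Finite (IwasawaAlgebra p) D.X := D.module_finite_holds hγ
  obtain ⟨hrank, hfin⟩ := hGZK W (by omega)
  have hr1 : W.mordellWeilRank = 1 := by rw [hrank, hr]
  haveI : Finite W.sha := hfin
  haveI hfinp : Finite (AddCommGroup.primaryComponent W.sha p) := inferInstance
  -- Jones: `ord_T g ≥ 1` and the leading term at order `1` (split shape)
  obtain ⟨hle, -, h3⟩ := hJ W p hp Dq κ γ hκ hγ hγ' D hX g hchar Dh hDh
  obtain ⟨u, hu⟩ := h3 hSch hfinp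
  rw [hr1] at hle hu
  -- `c · [T²]L = g₁ · w(0)`
  have hι : c * PowerSeries.coeff 2 L =
      ((PowerSeries.coeff 1 g * PowerSeries.constantCoeff (w : IwasawaAlgebra p) : ℤ_[p]) : ℚ_[p]) := by
    have := coeff_eq_mul_constantCoeff_of_le_order (w : IwasawaAlgebra p) hle 1 (c := c) (L := L)
      (by simpa using hw)
    simpa using this
  have hwu : IsUnit (PowerSeries.constantCoeff (w : IwasawaAlgebra p)) :=
    PowerSeries.isUnit_constantCoeff _ w.isUnit
  -- the core, with `B = log_p(γ)² · #T²`, `M = 𝓛_p · Reg_p · ∏ c_v`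
  have hReg : padicRegulator Dh ≠ 0 := hSch
  have h𝓛 : LInvariant Dq ≠ 0 := LInvariant_ne_zero_holds (W := W) (p := p) Dq
  have hc0 : (W.tamagawaProduct : ℚ_[p]) ≠ 0 := by
    exact_mod_cast (W.tamagawaProduct_pos_holds : 0 < W.tamagawaProduct).ne'
  have hM : LInvariant Dq * padicRegulator Dh * (W.tamagawaProduct : ℚ_[p]) ≠ 0 :=
    mul_ne_zero (mul_ne_zero h𝓛 hReg) hc0
  have hS : Nat.card (AddCommGroup.primaryComponent W.sha p) ≠ 0 := Nat.card_pos.ne'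
  have hval : padicValRat p s = padicValNat p (Nat.card (AddCommGroup.primaryComponent W.sha p)) :=
    padicValRat_eq_padicValNat_of_leadingTerms (p := p) hwu hM hS u u'
      (cL := c * PowerSeries.coeff 2 L)
      (B := padicLog p (cyclotomicGenerator p) ^ 2 * (W.torsionOrder : ℚ_[p]) ^ 2) hι
      (by linear_combination hu) (by linear_combination hDis)
  exact ⟨hrank, hfinp, s, hs, hval⟩

end Datum

/-! ### Class level on the (ram) atom: every datum discharged by tree theorems / named facts -/

section Class

variable (W : WeierstrassCurve ℚ) [W.IsElliptic] [W.IsGloballyMinimal] (p : ℕ) [Fact p.Prime]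

/-- **N8/O2 sub-class "(ram) ∧ non-split", ANY odd `p` (so `p = 3` included): `BSD(E,p)` for every
X11b pair (`ord_{s=1} L(E,s) = 1`, `p ≠ 2`, `p ‖ N`, `E[p]` irreducible) that is NON-SPLIT at `p`
and has a (ram) prime, from PUBLISHED named facts — Skinner 2016 Thm. A (`hA`), Stein–Wuthrich 2013
Thm. 6.1 non-split (`hJ`), SW §4.2 height existence (`hH`), Disegni 2020 Thm. 1 (`hD`), GZK
(`hGZK`), modularity (`hmod`: a modular parametrisation, for the newform and `ϖ`) — and ONE per-pair
input: `SchneiderConjecture Dh` for THE §4.2 datum (`hSch`, quantified over the pinned data; the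
datum is unique, `IsMultCanonical.unique`).** All other data (cyclotomic pair, `X(E/ℚ_∞)`, THE
non-split MTT function, the Tate parameter) are instantiated from tree theorems. NO `p ∤ #Ш_an`, NO
Tamagawa / Heegner / anticyclotomic hypothesis. CONDITIONAL on the facts and on `hSch`; nothing
booked; X11b stays CONSTRUCTION-SHAPED. [cite: Skinner2016PacificMC, Thm. A (§1), §3.2–3.3]
[cite: SteinWuthrich2013, Thm. 6.1 (p. 20), §4.2] [cite: Disegni2020, Thm. 1 (§1.2)]
[cite: Miller2011LMS, Def. 1.1] -/
theorem bsdp_of_ram_nonsplit_of_schneider (hA : thmA_charIdeal_multiplicative)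
    (hJ : thm61_nonsplitMultiplicative) (hH : exists_isMultCanonical)
    (hGZK : rank_eq_analyticRank_of_analyticRank_le_one) (hpar : nonempty_modularParametrizationData)
    -- Disegni 2020 Thm. 1, NON-SPLIT clause, AT the pair `(W, p)` (inline: the named fact
    -- `Disegni2020.thm1_padicBSD_rankOne_multiplicative` lands separately; see `ClassClosureTyped`)
    (hD : ∀ {N : ℕ} [NeZero N] {f : CuspForm (Gamma0 N) 2}, IsNewformOf W f →
      ∀ (ϖ : ℚ), ϖ ≠ 0 → (ϖ : ℝ) * W.realPeriodRat = plusPeriod f →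
      ∀ (q : ℚ_[p]), q ≠ 0 → ‖q‖ < 1 → tateJ q = (W.j : ℚ_[p]) →
      ∀ (L : PowerSeries ℚ_[p]), IsMultPAdicLFunctionOf f p (-1) L →
      ∀ (Dh : PAdicHeightData W p), IsMultCanonical Dh q →
        ∃ (s : ℚ) (u : ℤ_[p]ˣ), shaAn W = (s : ℂ) ∧
          ((ϖ : ℚ) : ℚ_[p]) * PowerSeries.coeff 1 L * padicLog p (cyclotomicGenerator p) *
              (W.torsionOrder : ℚ_[p]) ^ 2 =
            ((u : ℤ_[p]) : ℚ_[p]) * (2 * ((s : ℚ_[p]) * padicRegulator Dh * W.tamagawaProduct)))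
    (hX : ClassX11b W p) (hns : ¬ W.HasSplitMultiplicativeReductionAtPrime p) (hram : Ram W p)
    (hSch : ∀ (q : ℚ_[p]) (Dh : PAdicHeightData W p), q ≠ 0 → ‖q‖ < 1 → tateJ q = (W.j : ℚ_[p]) →
      IsMultCanonical Dh q → SchneiderConjecture Dh) :
    BSDp W p := by
  obtain ⟨hr, hp2, hmult, hirr⟩ := hX
  have hpP : p.Prime := Fact.out
  have hp3 : 3 ≤ p := by
    rcases hpP.eq_two_or_odd' with h | h
    · exact absurd h hp2
    · have := hpP.two_le; omega
  -- data from tree theorems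
  obtain ⟨κ, hκ, γ, hγ, hγ'⟩ := exists_isCyclotomic_isTopGenerator_isCyclotomicVariable_holds p
  obtain ⟨D⟩ := W.nonempty_selmerDualData_holds κ γ hγ
  haveI : NeZero (W.conductorNorm ℤ) := ⟨(W.conductorNorm_pos_holds).ne'⟩
  obtain ⟨Dm⟩ := hpar W
  obtain ⟨ϖ, hϖpos, hϖ, -⟩ := Dm.exists_rat_mul_realPeriodRat_eq_plusPeriod
  obtain ⟨L, hL⟩ := exists_isMultPAdicLFunctionOf_neg_one_of_nonsplit Dm.isNewformOf hmult hns
  obtain ⟨q, ⟨hq0, hq1, hqj⟩, -⟩ := existsUnique_tateJ_eq_of_one_lt_norm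
    (one_lt_norm_j_of_hasMultiplicativeReductionAtPrime (W := W) (p := p) hmult)
  obtain ⟨Dh, hDh⟩ := hH W p hp2 hmult hns q hq0 hq1 hqj
  -- (MC=) Skinner Thm. A for this data
  obtain ⟨hXt, g, hchar, -, hnsp⟩ := hA W p hp3 hmult hirr hram hκ hγ hγ' Dm.isNewformOf D ϖ
    hϖpos.ne' hϖ
  obtain ⟨w, hw⟩ := hnsp hns L hL
  -- (D) Disegni Thm. 1, non-split clause
  obtain ⟨s, u', hs, hDis⟩ := hD Dm.isNewformOf ϖ hϖpos.ne' hϖ q hq0 hq1 hqj L hL Dh hDh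
  exact bsdp_of_nonsplit_of_relativeLeadingTerm_of_schneider W p hJ hGZK hp2 hr hmult hns hq0 hq1 hqj
    hκ hγ hγ' D hXt hchar w hw Dh hDh hs u' hDis (hSch q Dh hq0 hq1 hqj hDh)

/-- **N8/O2 sub-class "(ram) ∧ split ∧ `p ≥ 5`": `BSD(E,p)` for every X11b pair SPLIT multiplicative
at `p ≥ 5` with a (ram) prime, from the PUBLISHED named facts (Skinner Thm. A `hA`, SW Thm. 6.1 split
`hJ`, SW §4.2 split-height existence `hH`, Disegni Thm. 1 `hD` — its hypothesis (∗) "a second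
multiplicative prime" is the (ram) prime —, GZK, modularity) and ONE per-pair input
`SchneiderConjecture Dh` for THE modified §4.2 datum; `𝓛_p ≠ 0` is a tree theorem.** CONDITIONAL;
nothing booked. [cite: Skinner2016PacificMC, Thm. A (§1), §3.2–3.3]
[cite: SteinWuthrich2013, Thm. 6.1 (p. 20), §4.2] [cite: Disegni2020, Thm. 1 (§1.2), hypothesis (∗)]
[cite: Miller2011LMS, Def. 1.1] -/
theorem bsdp_of_ram_split_of_five_le_of_schneider (hA : thmA_charIdeal_multiplicative)
    (hJ : thm61_splitMultiplicative) (hH : exists_isSplitMultCanonical)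
    (hGZK : rank_eq_analyticRank_of_analyticRank_le_one) (hpar : nonempty_modularParametrizationData)
    -- Disegni 2020 Thm. 1, SPLIT clause (hypothesis (∗)), AT the pair `(W, p)` (inline)
    (hD : ∀ {N : ℕ} [NeZero N] {f : CuspForm (Gamma0 N) 2}, IsNewformOf W f →
      ∀ (ϖ : ℚ), ϖ ≠ 0 → (ϖ : ℝ) * W.realPeriodRat = plusPeriod f →
      5 ≤ p → (∃ (m : ℕ) (_ : Fact m.Prime), m ≠ p ∧ W.HasMultiplicativeReductionAtPrime m) →
      ∀ (Dq : TateParameterData W p) (L : PowerSeries ℚ_[p]), IsSplitMultPAdicLFunctionOf f p L →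
      ∀ (Dh : PAdicHeightData W p), IsSplitMultCanonical Dh Dq →
        ∃ (s : ℚ) (u : ℤ_[p]ˣ), shaAn W = (s : ℂ) ∧
          ((ϖ : ℚ) : ℚ_[p]) * PowerSeries.coeff 2 L * padicLog p (cyclotomicGenerator p) ^ 2 *
              (W.torsionOrder : ℚ_[p]) ^ 2 =
            ((u : ℤ_[p]) : ℚ_[p]) *
              (LInvariant Dq * ((s : ℚ_[p]) * padicRegulator Dh * W.tamagawaProduct)))
    (hX : ClassX11b W p) (hsplit : W.HasSplitMultiplicativeReductionAtPrime p) (hram : Ram W p)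
    (hp5 : 5 ≤ p)
    (hSch : ∀ (Dq : TateParameterData W p) (Dh : PAdicHeightData W p),
      IsSplitMultCanonical Dh Dq → SchneiderConjecture Dh) :
    BSDp W p := by
  obtain ⟨hr, hp2, hmult, hirr⟩ := hX
  have hp3 : 3 ≤ p := by omega
  obtain ⟨κ, hκ, γ, hγ, hγ'⟩ := exists_isCyclotomic_isTopGenerator_isCyclotomicVariable_holds p
  obtain ⟨D⟩ := W.nonempty_selmerDualData_holds κ γ hγ
  haveI : NeZero (W.conductorNorm ℤ) := ⟨(W.conductorNorm_pos_holds).ne'⟩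
  obtain ⟨Dm⟩ := hpar W
  obtain ⟨ϖ, hϖpos, hϖ, -⟩ := Dm.exists_rat_mul_realPeriodRat_eq_plusPeriod
  obtain ⟨L, hL⟩ := exists_isSplitMultPAdicLFunctionOf hsplit Dm.isNewformOf
  obtain ⟨Dq⟩ := (nonempty_tateParameterData_iff_holds (W := W) (p := p)).mpr hsplit
  obtain ⟨Dh, hDh⟩ := hH W p hp2 Dq
  -- (MC=) Skinner Thm. A for this data (split clause)
  obtain ⟨hXt, g, hchar, hsp, -⟩ := hA W p hp3 hmult hirr hram hκ hγ hγ' Dm.isNewformOf D ϖ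
    hϖpos.ne' hϖ
  obtain ⟨w, hw⟩ := hsp hsplit L hL
  -- (D) Disegni Thm. 1, split clause: the second multiplicative prime is the (ram) prime
  have hm : ∃ (m : ℕ) (_ : Fact m.Prime), m ≠ p ∧ W.HasMultiplicativeReductionAtPrime m := by
    obtain ⟨ℓ, hℓ, hℓp, hmℓ, -⟩ := hram
    exact ⟨ℓ, hℓ, hℓp, hmℓ⟩
  obtain ⟨s, u', hs, hDis⟩ := hD Dm.isNewformOf ϖ hϖpos.ne' hϖ hp5 hm Dq L hL Dh hDh
  exact bsdp_of_split_of_relativeLeadingTerm_of_schneider W p hJ hGZK hp2 hr Dq hκ hγ hγ' D hXt hchar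
    w hw Dh hDh hs u' hDis (hSch Dq Dh hDh)

end Class

end Summit.BirchSwinnertonDyer.Rank1Residual.X11b

end
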